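import Summits.ResolutionOfSingularities.ResolutionOfSingularities.Theorems.WeightedInvariantIota3LevelsExtendedOfCollapse
import HarnessLib

/-!
# The σ/J ideal-descent inputs of `stub_keyRungGrHomLE_three` MERGED: levels of upstairs flags reaching an EXACTLY ratio-maximal triple
# (door `HypersurfaceCentreConstruction`, stmt-ResolutionOfSingularities-19897; P3 rung; gaps (σ-ext)₃ / GAP 2)

Topic: `Summits/ResolutionOfSingularities/ResolutionOfSingularities/Theorems`. Helper for the door item `HypersurfaceCentreConstruction`
(stmt-ResolutionOfSingularities-19897, route `WeightedInvariant`), line `local-engine` (skeleton v3.12 `7a4b52ef`), def-free.  Sequel of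
`keyRungGrHomLE_three_of_idealDescentLT3` (…Iota3LevelsExtendedOfCollapse, p820151), whose GAP-2 inputs were (IDLmax-desc)₃ (levels of upstairs
σ-maximisers) and (EX-asc)₃ (a maximiser downstairs ⇒ one upstairs).  Both are replaced by ONE ideal-descent statement in EXACT cross-multiplied
form,

  **(IDLexact)₃** «`φ : A → A'` (regular local, dimension three, 𝔪-preserving, local formally smooth e.f.t.), `g ∈ 𝔪_A ∖ 0`, `ν = ord g`; a two-flag
  `(g₁', g₂')` of `A'` carrying `φ g` to an admissible `(q; r₁, r₂)` with `q < r₂` whose ratio is EXACTLY MAXIMAL upstairs (`r₁'·r₂ ≤ r₁·r₂'` for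
  every admissible `(q'; r₁', r₂')` reached by `φ g`) ⇒ `F'(r₁)`, `F'(r₂)` are extended from `A`»,

because (§1) ONE-MEMBER DESCENT BOUNDS THE UPSTAIRS RATIOS EXACTLY: if `(G₁, G₂; q, r₁, r₂)` is a σ-maximiser of `g` downstairs then every triple
reached by `φ g` upstairs has ratio `≤ r₁/r₂` (`ratio_le_of_flagReaches_algebraMap`: the first member descends by
`JFlatEssSmooth.oneFlagReaches_of_algebraMap`, becomes a coarse two-flag reach downstairs, and meets the maximality of `G`); so the image of a
downstairs maximiser reaches an exactly ratio-maximal triple, upstairs maximisers do too (lex-maximality), and (§1–§2):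
* `isSigmaMaximiser_algebraMap_of_exactDescent` — the image of a downstairs σ-maximiser IS an upstairs σ-maximiser, given descent of the
  upstairs reaches at its exact ratio (no (EX) needed);
* `jSigmaPtLocal_map_eq_of_images` (any flat algebra of local rings, `𝔪S' = 𝔪'`) — `jSigmaPtLocal` commutes with `φ` as soon as images of
  downstairs maximisers are upstairs maximisers and upstairs maximisers have the filtration of an image flag;
* **`jSigmaPt_map_eq_of_exactIdealDescent`**, `gap2_of_exactIdealDescent` — GAP 2 ⟸ (IDLexact)₃;
* §3 **`keyRungGrHomLE_three_of_idealDescentExact3`** — the gap list with FIVE hypotheses: (desc-τ), (IDL-desc)₃ (letter form: triples with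
  `ν!·r₁ = σ₁·r₂`, feeding (σ-ext)₃), (IDLexact)₃ (exact form, feeding GAP 2), hgame, the residue of the dominance word at the power positions.
  The two ideal-descent hypotheses are the SAME statement up to the exactness obligation (R6) of …Iota3Sigma (that `ν!` clears the denominator
  of the maximal ratio), which is what identifies «`ν!·r₁ = σ₁·r₂`» with «exactly ratio-maximal».

[OURS · L1 W4.3 · kernel lemmas + audit glue]  Replaces the role of NO printed item; NOT a statement of the manuscript
[claim: Hironaka2017, status: under-review]; candidates stay candidates; AI work, weaker than expert review.  No definition; no axiom.

## References

* H. Hironaka, *Characteristic polyhedra of singularities*, J. Math. Kyoto Univ. 7 (1967), §3, Thm. (4.8). [Hironaka1967]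
* H. Matsumura, *Commutative Ring Theory* (1987), Thm. 7.5. [Matsumura1987]
-/

noncomputable section

set_option linter.dupNamespace false -- mandated namespace `Summit.<Summit>.<Problem>` of this single-conjunct summit

open IsLocalRing Literature.AlgebraicGeometry.Resolution
open Summit.ResolutionOfSingularities.ResolutionOfSingularities.Theorems
open Summit.ResolutionOfSingularities.ResolutionOfSingularities.Cruxes.HypersurfaceCentreConstruction.LocalEngine.Iota3.RatContact

namespace Summit.ResolutionOfSingularities.ResolutionOfSingularities.Cruxes.HypersurfaceCentreConstruction.LocalEngine

namespace Iota3

/-! ## §1 `jSigmaPtLocal` from a correspondence of maximisers (any flat algebra of local rings) -/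

section Images

variable {S S' : Type} [CommRing S] [CommRing S'] [IsLocalRing S] [IsLocalRing S'] [Algebra S S'] [Module.Flat S S']
  (hm : (maximalIdeal S).map (algebraMap S S') = maximalIdeal S')
include hm

/-- **`jSigmaPtLocal` COMMUTES WITH `φ` FROM A CORRESPONDENCE OF MAXIMISERS**: images of downstairs σ-maximisers are upstairs σ-maximisers, and
every upstairs σ-maximiser has the filtration of the image of a downstairs two-flag ⇒ `jSigmaPtLocal (φ f) m = (jSigmaPtLocal f m)·S'`.
[OURS · L1 W4.3 · GAP 2 mechanism] -/
theorem jSigmaPtLocal_map_eq_of_images {f : S} (hf0 : f ≠ 0) (hfu : ¬ IsUnit f)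
    (himg : ∀ (G₁ G₂ : S) (q r₁ r₂ : ℕ), IsSigmaMaximiser f (adicOrder f).toNat G₁ G₂ q r₁ r₂ →
      IsSigmaMaximiser (algebraMap S S' f) (adicOrder f).toNat (algebraMap S S' G₁) (algebraMap S S' G₂) q r₁ r₂)
    (hdesc : ∀ (g₁' g₂' : S') (q r₁ r₂ : ℕ), IsSigmaMaximiser (algebraMap S S' f) (adicOrder f).toNat g₁' g₂' q r₁ r₂ →
      ∃ g₁ g₂ : S, IsTwoFlag g₁ g₂ ∧
        ∀ n, flagContactFiltration (algebraMap S S' g₁) (algebraMap S S' g₂) q r₁ r₂ n = flagContactFiltration g₁' g₂' q r₁ r₂ n)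
    (m : ℕ) : jSigmaPtLocal (algebraMap S S' f) m = (jSigmaPtLocal f m).map (algebraMap S S') := by
  haveI : IsLocalHom (algebraMap S S') := isLocalHom_of_map_maximalIdeal_eq hm
  have hf0' : algebraMap S S' f ≠ 0 := fun h => hf0 (by
    have h1 := (mem_iff_algebraMap_mem_map_of_flat hm (⊥ : Ideal S) f).mpr (by rw [Ideal.map_bot, h]; exact Ideal.zero_mem _)
    exact (Submodule.mem_bot S).mp h1)
  have hfu' : ¬ IsUnit (algebraMap S S' f) := fun h => hfu ((isUnit_map_iff (algebraMap S S') f).mp h)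
  have hν : (adicOrder (algebraMap S S' f)).toNat = (adicOrder f).toNat := by rw [adicOrder_algebraMap_eq_of_flat hm]
  rw [jSigmaPtLocal_of_ne hf0' hfu', jSigmaPtLocal_of_ne hf0 hfu, hν]
  simp only [Ideal.map_iSup]
  refine le_antisymm ?_ ?_
  · refine iSup_le fun g₁' => iSup_le fun g₂' => iSup_le fun q => iSup_le fun r₁ => iSup_le fun r₂ => iSup_le fun h => ?_
    obtain ⟨g₁, g₂, hfl, heq⟩ := hdesc g₁' g₂' q r₁ r₂ h.1
    have hmax' := isSigmaMaximiser_of_filtration_eq hm h.1 hfl heq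
    refine le_iSup_of_le g₁ (le_iSup_of_le g₂ (le_iSup_of_le q (le_iSup_of_le r₁ (le_iSup_of_le r₂ (le_iSup_of_le ⟨hmax', h.2⟩ ?_)))))
    rw [map_flagContactFiltration_eq (algebraMap S S') hm, heq m]
  · refine iSup_le fun G₁ => iSup_le fun G₂ => iSup_le fun q => iSup_le fun r₁ => iSup_le fun r₂ => iSup_le fun h => ?_
    refine le_iSup_of_le (algebraMap S S' G₁) (le_iSup_of_le (algebraMap S S' G₂) (le_iSup_of_le q (le_iSup_of_le r₁
      (le_iSup_of_le r₂ (le_iSup_of_le ⟨himg G₁ G₂ q r₁ r₂ h.1, h.2⟩ ?_)))))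
    rw [map_flagContactFiltration_eq (algebraMap S S') hm]

end Images

/-! ## §2 Dimension three: one-member descent bounds the upstairs ratios exactly -/

section DimThree

variable {S S' : Type} [CommRing S] [CommRing S'] [IsRegularLocalRing S] [IsRegularLocalRing S'] [Algebra S S']
  [IsLocalHom (algebraMap S S')] [Algebra.FormallySmooth S S'] [Algebra.EssFiniteType S S']

/-- **UPSTAIRS RATIOS ARE BOUNDED BY THE DOWNSTAIRS MAXIMUM, EXACTLY**: if `(G₁, G₂; q, r₁, r₂)` is a σ-maximiser of `f ∈ 𝔪 ∖ 0` downstairs, every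
admissible `(q'; r₁', r₂')` reached by `φ f` upstairs has `r₁'·r₂ ≤ r₁·r₂'` (its first member reaches `r₁'/r₂'`, descends by one-member descent, and
gives the coarse two-flag reach `(r₂'; r₁', r₂')` downstairs). [cite: Hironaka1967, §3, Thm. (4.8)] [OURS · L1 W4.3] -/
theorem ratio_le_of_flagReaches_algebraMap (h𝔪 : (maximalIdeal S).map (algebraMap S S') = maximalIdeal S')
    (hdim : ringKrullDim S = (3 : ℕ)) (hdim' : ringKrullDim S' = (3 : ℕ)) {f : S} (hf0 : f ≠ 0) (hf : f ∈ maximalIdeal S)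
    {G₁ G₂ : S} {q r₁ r₂ : ℕ} (hG : IsSigmaMaximiser f (adicOrder f).toNat G₁ G₂ q r₁ r₂) {q' r₁' r₂' : ℕ}
    (hadm' : AdmissibleTriple q' r₁' r₂') (hreach : FlagReaches (algebraMap S S' f) (adicOrder f).toNat q' r₁' r₂') :
    r₁' * r₂ ≤ r₁ * r₂' := by
  have hr₂' : 0 < r₂' := hadm'.pos.2.1
  have hdown : FlagReaches f (adicOrder f).toNat r₂' r₁' r₂' :=
    JFlatEssSmooth.flagReaches_of_oneFlagReaches hdim
      (JFlatEssSmooth.oneFlagReaches_of_algebraMap h𝔪 hdim hdim' hf0 hf hr₂' r₁' (FlagReaches.oneFlagReaches hadm' hreach))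
  rcases hG.2.2.2 r₂' r₁' r₂' ⟨hr₂', le_rfl, hadm'.2.2⟩ hdown with h | ⟨h, -⟩
  · exact h.le
  · exact h.le

/-- **The image of a downstairs σ-maximiser is an upstairs σ-maximiser**, given that the upstairs reaches AT ITS EXACT RATIO with `q' < r₂'` descend
(the coarse ones `q' = r₂'` descend outright; the ratio comparison is `ratio_le_of_flagReaches_algebraMap`). [OURS · L1 W4.3] -/
theorem isSigmaMaximiser_algebraMap_of_exactDescent (h𝔪 : (maximalIdeal S).map (algebraMap S S') = maximalIdeal S')
    (hdim : ringKrullDim S = (3 : ℕ)) (hdim' : ringKrullDim S' = (3 : ℕ)) {f : S} (hf0 : f ≠ 0) (hf : f ∈ maximalIdeal S)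
    {G₁ G₂ : S} {q r₁ r₂ : ℕ} (hG : IsSigmaMaximiser f (adicOrder f).toNat G₁ G₂ q r₁ r₂)
    (hdescρ : ∀ q' r₁' r₂' : ℕ, AdmissibleTriple q' r₁' r₂' → q' < r₂' → r₁' * r₂ = r₁ * r₂' →
      FlagReaches (algebraMap S S' f) (adicOrder f).toNat q' r₁' r₂' → FlagReaches f (adicOrder f).toNat q' r₁' r₂') :
    IsSigmaMaximiser (algebraMap S S' f) (adicOrder f).toNat (algebraMap S S' G₁) (algebraMap S S' G₂) q r₁ r₂ := by
  haveI : Module.Flat S S' := IotaOrderEssSmooth.flat_of_formallySmooth_of_essFiniteType S S'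
  obtain ⟨hadm, hfl, hmem, hlex⟩ := hG
  refine ⟨hadm, hfl.algebraMap_of_flat h𝔪, map_mem_flagContactFiltration (algebraMap S S') h𝔪.le hmem,
    fun q' r₁' r₂' hadm' hreach => ?_⟩
  have hle := ratio_le_of_flagReaches_algebraMap h𝔪 hdim hdim' hf0 hf ⟨hadm, hfl, hmem, hlex⟩ hadm' hreach
  rcases hle.lt_or_eq with hlt | heq
  · exact Or.inl hlt
  · -- exact ratio tie: the reach descends, then downstairs maximality
    refine hlex q' r₁' r₂' hadm' ?_
    rcases hadm'.2.1.eq_or_lt with hq | hq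
    · subst hq
      exact flagReaches_of_algebraMap_dim3_of_r₂_eq_q h𝔪 hdim hdim' hf0 hf hadm'.1 hadm'.2.2 hreach
    · exact hdescρ q' r₁' r₂' hadm' hq heq hreach

/-- An upstairs σ-maximiser's triple is exactly ratio-maximal upstairs. [folklore] -/
theorem IsSigmaMaximiser.ratio_le {R : Type} [CommRing R] [IsLocalRing R] {f : R} {ν : ℕ} {g₁ g₂ : R} {q r₁ r₂ : ℕ}
    (h : IsSigmaMaximiser f ν g₁ g₂ q r₁ r₂) {q' r₁' r₂' : ℕ} (hadm' : AdmissibleTriple q' r₁' r₂') (hreach : FlagReaches f ν q' r₁' r₂') :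
    r₁' * r₂ ≤ r₁ * r₂' := by
  rcases h.2.2.2 q' r₁' r₂' hadm' hreach with hlt | ⟨heq, -⟩
  · exact hlt.le
  · exact heq.le

/-- **GAP 2 for one `g` FROM (IDLexact)**: the levels of every upstairs two-flag carrying `φ g` to an EXACTLY ratio-maximal triple with `q < r₂` are
extended ⇒ `jSigmaPt S' (φ g) m = (jSigmaPt S g m)·S'`. [OURS · L1 W4.3 · GAP 2 ⟸ (IDLexact)₃] -/
theorem jSigmaPt_map_eq_of_exactIdealDescent (h𝔪 : (maximalIdeal S).map (algebraMap S S') = maximalIdeal S')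
    (hdim : ringKrullDim S = (3 : ℕ)) (hdim' : ringKrullDim S' = (3 : ℕ)) (g : S)
    (hidl : g ≠ 0 → g ∈ maximalIdeal S → ∀ (g₁' g₂' : S') (q r₁ r₂ : ℕ), IsTwoFlag g₁' g₂' → AdmissibleTriple q r₁ r₂ → q < r₂ →
      algebraMap S S' g ∈ flagContactFiltration g₁' g₂' q r₁ r₂ (r₁ * (adicOrder g).toNat) →
      (∀ q' r₁' r₂' : ℕ, AdmissibleTriple q' r₁' r₂' → FlagReaches (algebraMap S S' g) (adicOrder g).toNat q' r₁' r₂' → r₁' * r₂ ≤ r₁ * r₂') →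
      ∃ J₁ J₂ : Ideal S, J₁.map (algebraMap S S') = flagContactFiltration g₁' g₂' q r₁ r₂ r₁ ∧
        J₂.map (algebraMap S S') = flagContactFiltration g₁' g₂' q r₁ r₂ r₂)
    (m : ℕ) : jSigmaPt S' (algebraMap S S' g) m = (jSigmaPt S g m).map (algebraMap S S') := by
  haveI : Module.Flat S S' := IotaOrderEssSmooth.flat_of_formallySmooth_of_essFiniteType S S'
  rw [jSigmaPt_eq, jSigmaPt_eq]
  by_cases hg0 : g = 0
  · subst hg0; rw [map_zero, jSigmaPtLocal_zero, jSigmaPtLocal_zero, Ideal.map_bot]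
  by_cases hgu : IsUnit g
  · rw [jSigmaPtLocal_of_isUnit hgu, jSigmaPtLocal_of_isUnit (hgu.map _), Ideal.map_top]
  have hg : g ∈ maximalIdeal S := (IsLocalRing.mem_maximalIdeal g).mpr (mem_nonunits_iff.mpr hgu)
  -- levels of an exactly ratio-maximal reaching flag are extended (all `q`: coarse ones by `levels_extended_of_r₂_eq_q`)
  have hext : ∀ (g₁' g₂' : S') (q r₁ r₂ : ℕ), IsTwoFlag g₁' g₂' → AdmissibleTriple q r₁ r₂ →
      algebraMap S S' g ∈ flagContactFiltration g₁' g₂' q r₁ r₂ (r₁ * (adicOrder g).toNat) →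
      (∀ q' r₁' r₂' : ℕ, AdmissibleTriple q' r₁' r₂' → FlagReaches (algebraMap S S' g) (adicOrder g).toNat q' r₁' r₂' → r₁' * r₂ ≤ r₁ * r₂') →
      ∃ J₁ J₂ : Ideal S, J₁.map (algebraMap S S') = flagContactFiltration g₁' g₂' q r₁ r₂ r₁ ∧
        J₂.map (algebraMap S S') = flagContactFiltration g₁' g₂' q r₁ r₂ r₂ := by
    intro g₁' g₂' q r₁ r₂ hfl hadm hmem hmaxρ
    rcases hadm.2.1.eq_or_lt with hq | hq
    · subst hq
      exact levels_extended_of_r₂_eq_q h𝔪 hdim hdim' hg0 hg hfl hadm.1 hadm.2.2 hmem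
    · exact hidl hg0 hg g₁' g₂' q r₁ r₂ hfl hadm hq hmem hmaxρ
  refine jSigmaPtLocal_map_eq_of_images h𝔪 hg0 hgu (fun G₁ G₂ q r₁ r₂ hG => ?_) (fun g₁' g₂' q r₁ r₂ hmax => ?_) m
  · -- images of downstairs maximisers are upstairs maximisers
    refine isSigmaMaximiser_algebraMap_of_exactDescent h𝔪 hdim hdim' hg0 hg hG fun q' r₁' r₂' hadm' hq' hρ hreach => ?_
    obtain ⟨h₁, h₂, hfl', hmem'⟩ := hreach
    -- the reached triple `(q'; r₁', r₂')` has the exact maximal ratio `r₁/r₂`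
    have hmaxρ : ∀ q'' r₁'' r₂'' : ℕ, AdmissibleTriple q'' r₁'' r₂'' →
        FlagReaches (algebraMap S S' g) (adicOrder g).toNat q'' r₁'' r₂'' → r₁'' * r₂' ≤ r₁' * r₂'' := by
      intro q'' r₁'' r₂'' hadm'' hreach''
      have h1 := ratio_le_of_flagReaches_algebraMap h𝔪 hdim hdim' hg0 hg hG hadm'' hreach''  -- r₁'' r₂ ≤ r₁ r₂''
      have hr₂ : 0 < r₂ := hG.1.pos.2.1
      refine Nat.le_of_mul_le_mul_left ?_ hr₂
      calc r₂ * (r₁'' * r₂') = (r₁'' * r₂) * r₂' := by ring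
        _ ≤ (r₁ * r₂'') * r₂' := Nat.mul_le_mul_right _ h1
        _ = (r₁ * r₂') * r₂'' := by ring
        _ = (r₁' * r₂) * r₂'' := by rw [hρ]
        _ = r₂ * (r₁' * r₂'') := by ring
    obtain ⟨J₁, J₂, hJ₁, hJ₂⟩ := hext h₁ h₂ q' r₁' r₂' hfl' hadm' hmem' hmaxρ
    exact JFlatEssSmooth.flagReaches_of_extended h𝔪 hfl' hadm' hJ₁ hJ₂ hmem'
  · -- upstairs maximisers have the filtration of an image flag
    have hν : (adicOrder (algebraMap S S' g)).toNat = (adicOrder g).toNat := by rw [adicOrder_algebraMap_eq_of_flat h𝔪]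
    obtain ⟨J₁, J₂, hJ₁, hJ₂⟩ := hext g₁' g₂' q r₁ r₂ hmax.2.1 hmax.1 hmax.2.2.1 fun q' r₁' r₂' hadm' hreach =>
      hmax.ratio_le hadm' hreach
    obtain ⟨g₁, g₂, hfl, -, -, heq⟩ := JFlatEssSmooth.exists_isTwoFlag_eq_of_extended h𝔪 hmax.2.1 hmax.1 hJ₁ hJ₂
    exact ⟨g₁, g₂, hfl, heq⟩

end DimThree

/-- **GAP 2 ⟸ (IDLexact)₃** in the binder shape of the gap lists. [OURS · L1 W4.3 · audit glue] -/
theorem gap2_of_exactIdealDescent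
    (hidl : ∀ (T T' : Type) [CommRing T] [IsRegularLocalRing T] [CommRing T'] [IsRegularLocalRing T'] [Algebra T T']
      [IsLocalHom (algebraMap T T')] [Algebra.FormallySmooth T T'] [Algebra.EssFiniteType T T'] (g : T),
      ringKrullDim T = (3 : ℕ) → ringKrullDim T' = (3 : ℕ) → (maximalIdeal T).map (algebraMap T T') = maximalIdeal T' →
      g ≠ 0 → g ∈ maximalIdeal T → ∀ (g₁' g₂' : T') (q r₁ r₂ : ℕ), IsTwoFlag g₁' g₂' → AdmissibleTriple q r₁ r₂ → q < r₂ →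
      algebraMap T T' g ∈ flagContactFiltration g₁' g₂' q r₁ r₂ (r₁ * (adicOrder g).toNat) →
      (∀ q' r₁' r₂' : ℕ, AdmissibleTriple q' r₁' r₂' → FlagReaches (algebraMap T T' g) (adicOrder g).toNat q' r₁' r₂' →
        r₁' * r₂ ≤ r₁ * r₂') →
      ∃ J₁ J₂ : Ideal T, J₁.map (algebraMap T T') = flagContactFiltration g₁' g₂' q r₁ r₂ r₁ ∧
        J₂.map (algebraMap T T') = flagContactFiltration g₁' g₂' q r₁ r₂ r₂) :
    ∀ (T T' : Type) [CommRing T] [IsRegularLocalRing T] [CommRing T'] [IsRegularLocalRing T'] [Algebra T T']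
      [IsLocalHom (algebraMap T T')] [Algebra.FormallySmooth T T'] [Algebra.EssFiniteType T T'] (g : T),
      ringKrullDim T' ≤ 3 → (maximalIdeal T).map (algebraMap T T') = maximalIdeal T' → ringKrullDim T = (3 : ℕ) →
      iotaEps T g = 0 → ∀ m : ℕ, jSigmaPt T' (algebraMap T T' g) m = (jSigmaPt T g m).map (algebraMap T T') := by
  intro T T' _ _ _ _ _ _ _ _ g _ h𝔪 hdim _ m
  have hdim' : ringKrullDim T' = (3 : ℕ) := (ringKrullDim_eq_of_map_maximalIdeal_eq (S := T) (S' := T') h𝔪).symm.trans hdim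
  exact jSigmaPt_map_eq_of_exactIdealDescent h𝔪 hdim hdim' g (hidl T T' g hdim hdim' h𝔪) m

end Iota3

/-! ## §3 The gap list -/

open Iota3 in
/-- **P3 RUNG FOR THE NAMED PAIR MODULO FIVE HYPOTHESES, σ/J-INPUTS = TWO FORMS OF ONE IDEAL-DESCENT STATEMENT**: (desc-τ); (IDL-desc)₃ (letter
form «`ν!·r₁ = σ₁·r₂`», feeding (σ-ext)₃); **(IDLexact)₃** (exact form «`r₁'·r₂ ≤ r₁·r₂'` for all upstairs reaches», feeding GAP 2); hgame; the
residue of the dominance word at the power positions.  All along 𝔪-preserving local formally smooth e.f.t. maps of regular local rings of dimension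
three, two-flags with `q < r₂`. [OURS · L1 W4.3 · audit glue] -/
theorem keyRungGrHomLE_three_of_idealDescentExact3 (p : ℕ)
    (hD : ∀ (T T' : Type) [CommRing T] [IsRegularLocalRing T] [CommRing T'] [IsRegularLocalRing T'] [Algebra T T']
      [IsLocalHom (algebraMap T T')] [Algebra.FormallySmooth T T'] [Algebra.EssFiniteType T T'] (g : T),
      ringKrullDim T' ≤ 3 → IsTiePosition T' (algebraMap T T' g) → IsTiePosition T g)
    (hidl : ∀ (A A' : Type) [CommRing A] [IsRegularLocalRing A] [CommRing A'] [IsRegularLocalRing A'] [Algebra A A']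
      [IsLocalHom (algebraMap A A')] [Algebra.FormallySmooth A A'] [Algebra.EssFiniteType A A'] (g : A),
      ringKrullDim A = (3 : ℕ) → ringKrullDim A' = (3 : ℕ) → (maximalIdeal A).map (algebraMap A A') = maximalIdeal A' →
      g ≠ 0 → g ∈ maximalIdeal A → ∀ q r₁ r₂ : ℕ, AdmissibleTriple q r₁ r₂ → q < r₂ →
      ratioScale (adicOrder g).toNat * r₁ = sigmaRatioNat g * r₂ →
      ∀ g₁' g₂' : A', IsTwoFlag g₁' g₂' →
      algebraMap A A' g ∈ flagContactFiltration g₁' g₂' q r₁ r₂ (r₁ * (adicOrder g).toNat) →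
      ∃ J₁ J₂ : Ideal A, J₁.map (algebraMap A A') = flagContactFiltration g₁' g₂' q r₁ r₂ r₁ ∧
        J₂.map (algebraMap A A') = flagContactFiltration g₁' g₂' q r₁ r₂ r₂)
    (hidlx : ∀ (T T' : Type) [CommRing T] [IsRegularLocalRing T] [CommRing T'] [IsRegularLocalRing T'] [Algebra T T']
      [IsLocalHom (algebraMap T T')] [Algebra.FormallySmooth T T'] [Algebra.EssFiniteType T T'] (g : T),
      ringKrullDim T = (3 : ℕ) → ringKrullDim T' = (3 : ℕ) → (maximalIdeal T).map (algebraMap T T') = maximalIdeal T' →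
      g ≠ 0 → g ∈ maximalIdeal T → ∀ (g₁' g₂' : T') (q r₁ r₂ : ℕ), IsTwoFlag g₁' g₂' → AdmissibleTriple q r₁ r₂ → q < r₂ →
      algebraMap T T' g ∈ flagContactFiltration g₁' g₂' q r₁ r₂ (r₁ * (adicOrder g).toNat) →
      (∀ q' r₁' r₂' : ℕ, AdmissibleTriple q' r₁' r₂' → FlagReaches (algebraMap T T' g) (adicOrder g).toNat q' r₁' r₂' →
        r₁' * r₂ ≤ r₁ * r₂') →
      ∃ J₁ J₂ : Ideal T, J₁.map (algebraMap T T') = flagContactFiltration g₁' g₂' q r₁ r₂ r₁ ∧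
        J₂.map (algebraMap T T') = flagContactFiltration g₁' g₂' q r₁ r₂ r₂)
    (hgame : CanonicalGameClauseHomLE 3 p iotaFlatT jFlatT)
    (hres : ∀ (k₀ : Type) [Field k₀] [CharP k₀ p] [PerfectField k₀]
      (S : Type) [CommRing S] [Algebra k₀ S] [Algebra.EssFiniteType k₀ S] [IsRegularLocalRing S] (f : S),
      ringKrullDim S = (3 : ℕ) → f ≠ 0 → f ∈ (maximalIdeal S) ^ 2 →
      ContactCylinder.topStratumPrime iotaOrdEpsTau S f = maximalIdeal S → iotaEps S f ≠ 1 →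
      (∃ ℓ ∈ maximalIdeal S, f ∈ Ideal.span {ℓ ^ (adicOrder f).toNat} ⊔ maximalIdeal S ^ ((adicOrder f).toNat + 1)) →
      ∀ (a b : ℕ), 0 < b →
      (∀ q' r₁' r₂' : ℕ, AdmissibleTriple q' r₁' r₂' → FlagReaches f (adicOrder f).toNat q' r₁' r₂' → r₁' * b ≤ a * r₂') →
      ∀ (g₁ g₂ g₁' g₂' : S) (q r₁ r₂ : ℕ), AdmissibleTriple q r₁ r₂ → r₁ * b = a * r₂ → q < r₂ → r₂ < r₁ →
        IsTwoFlag g₁ g₂ → IsTwoFlag g₁' g₂' →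
        f ∈ flagContactFiltration g₁ g₂ q r₁ r₂ (r₁ * (adicOrder f).toNat) →
        f ∈ flagContactFiltration g₁' g₂' q r₁ r₂ (r₁ * (adicOrder f).toNat) →
        g₂' ∈ flagContactFiltration g₁ g₂ q r₁ r₂ r₂) :
    KeyRungGrHomLE 3 p :=
  keyRungGrHomLE_three_of_idealDescent3 p hD hidl (gap2_of_exactIdealDescent hidlx) hgame hres

end Summit.ResolutionOfSingularities.ResolutionOfSingularities.Cruxes.HypersurfaceCentreConstruction.LocalEngine

end
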